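import Mathlib

/-!
# Route «KPlusLogSqLaw» — parametric max-weight independent set on a path: THE TWO-CHAIN CALCULUS (abstract record chains under one transposition)

HONEST FRAMING.  Helper toward the crux `WeakLifting` (item `stmt-ValiantsHypothesis-19561`, route `KPlusLogSqLaw`, cell `pub-symmetroid`,
seat val-sym-lift-p4 g24, 2026-08-29) on the line of its witness-plan stub `stub_tridiagonalSectorB` (tropical twin of the STATIC tridiagonal
sector = parametric maximum-weight independent set on a path; located theory `HOME/val-sym-lift-p4/SILENT-FLIP-LAW.md` §1,
`HOME/val-sym-lift-p4/TWO-CHAINS-EULER.md` §1).  Mathlib-only, ABSTRACT form of the two greedy record chains of the memo, so that the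
chain arguments of the located theory can be run in the kernel for every allowable sequence (pseudolines included) and instantiated to the
alternating folds of the prefix-sum arrangement afterwards.  A STATE is a height function `S : ℕ → β` into a linear order and a predicate
`Lr` on labels («left records») satisfying the GREEDY SEMANTICS with parity offset `e` on the labels `≤ n`: `Lr 0`, and whenever `p < u ≤ n`,
`Lr p` and no label strictly between `p` and `u` is a record («`p` is the nearest record left of `u`»), then `Lr u` iff `u` is INCORRECT with
respect to `p` — below it if `u + e` is even, above it if odd (`hSem`).  Right records are the same structure read from `n` downwards
(`hSemR`), and are reduced to left records of the reflected state (`semL_reflect_of_semR`).  Results: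
* `exists_nearest_left` / `exists_nearest_right` — nearest records exist; `nearest_left_unique`;
* `noRec_iff_good` — the labels strictly between a record `p` and `v` contain no record iff each is correct with respect to `p`;
* `noR_of_noL` / `noL_of_noR` — (F2 ⇒ gap) if `p` is a left record, `v > p` a right record, no left (resp. right) record strictly between,
  and `S p`, `S v` are ADJACENT (no third label of `[0, n]` between them), then no right (resp. left) record lies strictly between either;
* **`left_transposition`** — (F1) if two states differ by an adjacent transposition of the labels `a < c` (all other pairs compare the same
  way, values distinct, the pair adjacent in the first state), then the left records agree at every label `≠ c`, and agree at `c` too unless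
  `a` is the nearest left record of `c` — in which case `a` is the nearest left record of `c` in the second state as well (so the bit of `c`
  is read against `a` in both states and flips exactly when the pair does); **`right_transposition`** — the mirror statement at `a`.
Pure finite combinatorics; nothing here asserts anything about `WeakLifting`, `TropicalB`, `KPlusLogSqLaw`, the stub in its window,
`MatrixDescartes` (stmt-ValiantsHypothesis-18050) or `VP ≠ VNP`; the ORDER QUESTION stays open.
-/

set_option linter.dupNamespace false
set_option autoImplicit false

namespace Summit.ValiantsHypothesis.ValiantsHypothesis.Theorems.KPlusLogSqLaw

open Finset Classical

namespace StaticPathFold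

section TwoChains

variable {β : Type*} [LinearOrder β]

/-! ## 1. Nearest records -/

/-- the nearest left record of a positive label exists. [folklore] -/
theorem exists_nearest_left {Lr : ℕ → Prop} (hL0 : Lr 0) {u : ℕ} (hu : 0 < u) :
    ∃ p, p < u ∧ Lr p ∧ ∀ q, p < q → q < u → ¬ Lr q := by
  refine ⟨Nat.findGreatest Lr (u - 1), by have := Nat.findGreatest_le (P := Lr) (u - 1); omega,
    Nat.findGreatest_spec (P := Lr) (show 0 ≤ u - 1 by omega) hL0, fun q h1 h2 => ?_⟩
  exact Nat.findGreatest_is_greatest h1 (by omega)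

/-- the nearest right record of a label `< n` exists. [folklore] -/
theorem exists_nearest_right {Rr : ℕ → Prop} {n : ℕ} (hRn : Rr n) {u : ℕ} (hu : u < n) :
    ∃ r, u < r ∧ r ≤ n ∧ Rr r ∧ ∀ q, u < q → q < r → ¬ Rr q := by
  have hex : ∃ r, u < r ∧ Rr r := ⟨n, hu, hRn⟩
  refine ⟨Nat.find hex, (Nat.find_spec hex).1, ?_, (Nat.find_spec hex).2, fun q h1 h2 hq => ?_⟩
  · by_contra h
    exact Nat.find_min hex (show n < Nat.find hex by omega) ⟨hu, hRn⟩
  · exact Nat.find_min hex h2 ⟨h1, hq⟩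

/-- two nearest left records of the same label coincide. [folklore] -/
theorem nearest_left_unique {Lr : ℕ → Prop} {p p' u : ℕ} (hp : p < u) (hLp : Lr p) (hno : ∀ q, p < q → q < u → ¬ Lr q)
    (hp' : p' < u) (hLp' : Lr p') (hno' : ∀ q, p' < q → q < u → ¬ Lr q) : p = p' := by
  by_contra hne
  rcases lt_or_gt_of_ne hne with h | h
  · exact hno p' h hp' hLp'
  · exact hno' p h hp hLp

/-! ## 2. One state: clean stretches -/

/-- **no record strictly between `p` and `v` iff every label there is correct with respect to the record `p`.** [folklore] -/
theorem noRec_iff_good (S : ℕ → β) (e n : ℕ) {Lr : ℕ → Prop}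
    (hSem : ∀ p u, p < u → u ≤ n → Lr p → (∀ q, p < q → q < u → ¬ Lr q) →
      (Lr u ↔ ((Even (u + e) → S u < S p) ∧ (¬ Even (u + e) → S p < S u))))
    {p v : ℕ} (hp : Lr p) (hv : v ≤ n + 1) :
    (∀ q, p < q → q < v → ¬ Lr q) ↔
      (∀ q, p < q → q < v → ¬ ((Even (q + e) → S q < S p) ∧ (¬ Even (q + e) → S p < S q))) := by
  constructor
  · intro h q h1 h2
    rw [← hSem p q h1 (by omega) hp (fun q' h3 h4 => h q' h3 (by omega))]
    exact h q h1 h2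
  · intro h q
    induction q using Nat.strong_induction_on with
    | _ q ih =>
      intro h1 h2
      rw [hSem p q h1 (by omega) hp (fun q' h3 h4 => ih q' h4 h3 (by omega))]
      exact h q h1 h2

/-- correctness with respect to a reference transfers along an order-congruence of the two comparisons. [folklore] -/
theorem bad_congr {S S' : ℕ → β} {e u p p' : ℕ} (h1 : S u < S p ↔ S' u < S' p') (h2 : S p < S u ↔ S' p' < S' u) :
    ((Even (u + e) → S u < S p) ∧ (¬ Even (u + e) → S p < S u)) ↔
      ((Even (u + e) → S' u < S' p') ∧ (¬ Even (u + e) → S' p' < S' u)) := by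
  rw [h1, h2]

/-- two distinct-valued comparisons: `S p < S u ↔ S p' < S u` from `S u < S p ↔ S u < S p'`. [folklore] -/
theorem gt_congr_of_lt_congr {S : ℕ → β} {u p p' : ℕ} (hne : S u ≠ S p) (hne' : S u ≠ S p') (h : S u < S p ↔ S u < S p') :
    S p < S u ↔ S p' < S u := by
  constructor
  · intro h1
    exact lt_of_le_of_ne (not_lt.mp (fun h2 => lt_asymm h1 (h.mpr h2))) (Ne.symm hne')
  · intro h1
    exact lt_of_le_of_ne (not_lt.mp (fun h2 => lt_asymm h1 (h.mp h2))) (Ne.symm hne)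

/-! ## 3. Reflection: right records are left records of the reflected state -/

/-- **reflection**: if `Rr` has the greedy semantics read from the right with offset `e`, then `u ↦ Rr (n - u)` has the greedy semantics read
from the left for the reflected heights `u ↦ S (n - u)` with offset `e + n`. [folklore] -/
theorem semL_reflect_of_semR (S : ℕ → β) (e n : ℕ) {Rr : ℕ → Prop}
    (hSemR : ∀ u r, u < r → r ≤ n → Rr r → (∀ q, u < q → q < r → ¬ Rr q) →
      (Rr u ↔ ((Even (u + e) → S u < S r) ∧ (¬ Even (u + e) → S r < S u)))) :
    ∀ p u, p < u → u ≤ n → Rr (n - p) → (∀ q, p < q → q < u → ¬ Rr (n - q)) →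
      (Rr (n - u) ↔ ((Even (u + (e + n)) → S (n - u) < S (n - p)) ∧ (¬ Even (u + (e + n)) → S (n - p) < S (n - u)))) := by
  intro p u hpu hun hp hno
  have h := hSemR (n - u) (n - p) (by omega) (by omega) hp (fun q h1 h2 => by
    have := hno (n - q) (by omega) (by omega)
    rwa [show n - (n - q) = q by omega] at this)
  rw [h]
  have hpar : Even (n - u + e) ↔ Even (u + (e + n)) := by
    rw [Nat.even_add, Nat.even_add, Nat.even_add, Nat.even_sub hun]
    tauto
  rw [hpar]

/-- **(F2 ⇒ gap)**: `p < v ≤ n`, `p` a left record with no left record strictly before `v`, `v` a right record, `S p` and `S v` adjacent among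
the labels `≤ n` (values pairwise distinct) ⇒ no right record strictly between `p` and `v`. [folklore] -/
theorem noR_of_noL (S : ℕ → β) (e n : ℕ) {Lr Rr : ℕ → Prop}
    (hSem : ∀ p u, p < u → u ≤ n → Lr p → (∀ q, p < q → q < u → ¬ Lr q) →
      (Lr u ↔ ((Even (u + e) → S u < S p) ∧ (¬ Even (u + e) → S p < S u))))
    (hSemR : ∀ u r, u < r → r ≤ n → Rr r → (∀ q, u < q → q < r → ¬ Rr q) →
      (Rr u ↔ ((Even (u + e) → S u < S r) ∧ (¬ Even (u + e) → S r < S u))))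
    (hdis : ∀ p q, p ≤ n → q ≤ n → p ≠ q → S p ≠ S q)
    {p v : ℕ} (hpv : p < v) (hvn : v ≤ n) (hLp : Lr p) (hno : ∀ q, p < q → q < v → ¬ Lr q) (hRv : Rr v)
    (hadj : ∀ q, q ≤ n → q ≠ p → q ≠ v → (S q < S p ↔ S q < S v)) :
    ∀ q, p < q → q < v → ¬ Rr q := by
  -- every label strictly between is correct with respect to `p`, hence with respect to `v`
  have hgood := (noRec_iff_good S e n hSem hLp (by omega : v ≤ n + 1)).mp hno
  -- downward induction from `v`
  have key : ∀ d q, v - q = d → p < q → q < v → ¬ Rr q := by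
    intro d
    induction d using Nat.strong_induction_on with
    | _ d ih =>
      intro q hd h1 h2
      have hnoR : ∀ q', q < q' → q' < v → ¬ Rr q' := fun q' h3 h4 => ih (v - q') (by omega) q' rfl (by omega) h4
      rw [hSemR q v h2 hvn hRv hnoR]
      have hq := hgood q h1 h2
      have hqn : q ≤ n := by omega
      have e1 : S q < S p ↔ S q < S v := hadj q hqn (by omega) (by omega)
      have e2 : S p < S q ↔ S v < S q :=
        gt_congr_of_lt_congr (hdis q p hqn (by omega) (by omega)) (hdis q v hqn hvn (by omega)) e1
      rwa [e1, e2] at hq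
  exact fun q h1 h2 => key (v - q) q rfl h1 h2

/-- **(F2 ⇒ gap), mirror**: `p < v ≤ n`, `v` a right record with no right record strictly after `p`, `p` a left record, `S p` and `S v`
adjacent ⇒ no left record strictly between `p` and `v`. [folklore] -/
theorem noL_of_noR (S : ℕ → β) (e n : ℕ) {Lr Rr : ℕ → Prop}
    (hSem : ∀ p u, p < u → u ≤ n → Lr p → (∀ q, p < q → q < u → ¬ Lr q) →
      (Lr u ↔ ((Even (u + e) → S u < S p) ∧ (¬ Even (u + e) → S p < S u))))
    (hSemR : ∀ u r, u < r → r ≤ n → Rr r → (∀ q, u < q → q < r → ¬ Rr q) →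
      (Rr u ↔ ((Even (u + e) → S u < S r) ∧ (¬ Even (u + e) → S r < S u))))
    (hdis : ∀ p q, p ≤ n → q ≤ n → p ≠ q → S p ≠ S q)
    {p v : ℕ} (hpv : p < v) (hvn : v ≤ n) (hLp : Lr p) (hRv : Rr v) (hno : ∀ q, p < q → q < v → ¬ Rr q)
    (hadj : ∀ q, q ≤ n → q ≠ p → q ≠ v → (S q < S p ↔ S q < S v)) :
    ∀ q, p < q → q < v → ¬ Lr q := by
  refine (noRec_iff_good S e n hSem hLp (by omega : v ≤ n + 1)).mpr (fun q h1 h2 hbad => ?_)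
  have hqn : q ≤ n := by omega
  have hq : ¬ Rr q := hno q h1 h2
  rw [hSemR q v h2 hvn hRv (fun q' h3 h4 => hno q' (by omega) h4)] at hq
  have e1 : S q < S p ↔ S q < S v := hadj q hqn (by omega) (by omega)
  have e2 : S p < S q ↔ S v < S q :=
    gt_congr_of_lt_congr (hdis q p hqn (by omega) (by omega)) (hdis q v hqn hvn (by omega)) e1
  rw [e1, e2] at hbad
  exact hq hbad

/-! ## 4. (F1) One adjacent transposition: where the left records can change -/

/-- **(F1), left chain.**  Two states `(S, Lr)` and `(S', Lr')` with the greedy semantics (offset `e`, labels `≤ n`) such that all pairs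
other than `(a, c)`, `a < c ≤ n`, compare the same way, values are pairwise distinct in both, and no third label lies between `S a` and `S c`:
then the left records agree at every label `≠ c`; they agree at `c` unless `a` is the nearest left record of `c`; and if `a` is the nearest
left record of `c` in the first state it is so in the second. [folklore] -/
theorem left_transposition (S S' : ℕ → β) (e n a c : ℕ) {Lr Lr' : ℕ → Prop} (hac : a < c) (hcn : c ≤ n)
    (hL0 : Lr 0) (hL0' : Lr' 0)
    (hSem : ∀ p u, p < u → u ≤ n → Lr p → (∀ q, p < q → q < u → ¬ Lr q) →
      (Lr u ↔ ((Even (u + e) → S u < S p) ∧ (¬ Even (u + e) → S p < S u))))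
    (hSem' : ∀ p u, p < u → u ≤ n → Lr' p → (∀ q, p < q → q < u → ¬ Lr' q) →
      (Lr' u ↔ ((Even (u + e) → S' u < S' p) ∧ (¬ Even (u + e) → S' p < S' u))))
    (hord : ∀ p q, p ≤ n → q ≤ n → ¬(p = a ∧ q = c) → ¬(p = c ∧ q = a) → (S p < S q ↔ S' p < S' q))
    (hdis : ∀ p q, p ≤ n → q ≤ n → p ≠ q → S p ≠ S q)
    (hadj : ∀ q, q ≤ n → q ≠ a → q ≠ c → (S q < S a ↔ S q < S c)) :
    (∀ u, u ≤ n → u ≠ c → (Lr' u ↔ Lr u)) ∧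
      ((¬ (Lr a ∧ ∀ q, a < q → q < c → ¬ Lr q)) → (Lr' c ↔ Lr c)) ∧
      ((Lr a ∧ ∀ q, a < q → q < c → ¬ Lr q) → (Lr' a ∧ ∀ q, a < q → q < c → ¬ Lr' q)) := by
  have han : a ≤ n := hac.le.trans hcn
  -- semantics agree across the two states for a reference pair other than `{a, c}`
  have hbad : ∀ w p, w ≤ n → p ≤ n → ¬(w = a ∧ p = c) → ¬(w = c ∧ p = a) →
      (((Even (w + e) → S w < S p) ∧ (¬ Even (w + e) → S p < S w)) ↔
        ((Even (w + e) → S' w < S' p) ∧ (¬ Even (w + e) → S' p < S' w))) := by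
    intro w p hw hp h1 h2
    exact bad_congr (hord w p hw hp h1 h2) (hord p w hp hw (fun h => h2 ⟨h.2, h.1⟩) (fun h => h1 ⟨h.2, h.1⟩))
  -- reading `w ∉ {a, c}` against `a` or against `c` is the same
  have hac_ref : ∀ w, w ≤ n → w ≠ a → w ≠ c →
      (((Even (w + e) → S w < S a) ∧ (¬ Even (w + e) → S a < S w)) ↔
        ((Even (w + e) → S w < S c) ∧ (¬ Even (w + e) → S c < S w))) := by
    intro w hw hwa hwc
    have e1 := hadj w hw hwa hwc
    exact bad_congr e1 (gt_congr_of_lt_congr (hdis w a hw han hwa) (hdis w c hw hcn hwc) e1)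
  -- the joint induction
  have main : ∀ w, (w ≤ n → w ≠ c → (Lr' w ↔ Lr w)) ∧
      (w = c → ¬ (Lr a ∧ ∀ q, a < q → q < c → ¬ Lr q) → (Lr' c ↔ Lr c)) := by
    intro w
    induction w using Nat.strong_induction_on with
    | _ w ih =>
      constructor
      · intro hwn hwc
        rcases Nat.eq_zero_or_pos w with hw0 | hw0
        · subst hw0
          exact iff_of_true hL0' hL0
        obtain ⟨p, hpw, hLp, hnop⟩ := exists_nearest_left hL0 hw0
        have hpn : p ≤ n := by omega
        -- Case A: `c ∉ [p, w)`
        by_cases hA : p ≠ c ∧ ¬ (p < c ∧ c < w)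
        · have hLp' : Lr' p := ((ih p hpw).1 hpn hA.1).mpr hLp
          have hnop' : ∀ q, p < q → q < w → ¬ Lr' q := fun q h1 h2 hq =>
            hnop q h1 h2 (((ih q h2).1 (by omega) (by omega)).mp hq)
          rw [hSem' p w hpw hwn hLp' hnop', hSem p w hpw hwn hLp hnop]
          exact (hbad w p hwn hpn (fun h => hwc (by omega)) (fun h => hwc h.1)).symm
        · rw [not_and_or, not_not, not_not] at hA
          rcases hA with hpc | ⟨hpc, hcw⟩
          · -- Case B: `p = c`
            subst hpc
            have hwa : w ≠ a := by omega
            by_cases hc' : Lr' p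
            · have hnop' : ∀ q, p < q → q < w → ¬ Lr' q := fun q h1 h2 hq =>
                hnop q h1 h2 (((ih q h2).1 (by omega) (by omega)).mp hq)
              rw [hSem' p w hpw hwn hc' hnop', hSem p w hpw hwn hLp hnop]
              exact (hbad w p hwn hpn (fun h => hwa h.1) (fun h => hwc h.1)).symm
            · -- the bit of `c` differs, so `a` is the nearest left record of `c`, and of `w` in the second state
              have hna : Lr a ∧ ∀ q, a < q → q < p → ¬ Lr q := by
                by_contra h
                exact hc' (((ih p hpw).2 rfl h).mpr hLp)
              have hLa' : Lr' a := ((ih a (by omega)).1 han (by omega)).mpr hna.1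
              have hnoa' : ∀ q, a < q → q < w → ¬ Lr' q := by
                intro q h1 h2 hq
                rcases Nat.lt_trichotomy q p with h | h | h
                · exact hna.2 q h1 h (((ih q h2).1 (by omega) (by omega)).mp hq)
                · subst h; exact hc' hq
                · exact hnop q h h2 (((ih q h2).1 (by omega) (by omega)).mp hq)
              rw [hSem' a w (by omega) hwn hLa' hnoa', hSem p w hpw hwn hLp hnop,
                ← hbad w a hwn han (fun h => hwa h.1) (fun h => hwc h.1)]
              exact hac_ref w hwn hwa hwc
          · -- Case C: `p < c < w`
            have hwa : w ≠ a := by omega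
            have hncL : ¬ Lr c := hnop c hpc hcw
            by_cases hc' : Lr' c
            · -- the bit of `c` differs: `a` is its nearest left record, which is `p`
              have hna : Lr a ∧ ∀ q, a < q → q < c → ¬ Lr q := by
                by_contra h
                exact hncL (((ih c hcw).2 rfl h).mp hc')
              have hpa : p = a :=
                nearest_left_unique hpc hLp (fun q h1 h2 => hnop q h1 (by omega)) hac hna.1 hna.2
              subst hpa
              have hnoc' : ∀ q, c < q → q < w → ¬ Lr' q := fun q h1 h2 hq =>
                hnop q (by omega) h2 (((ih q h2).1 (by omega) (by omega)).mp hq)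
              rw [hSem' c w hcw hwn hc' hnoc', hSem p w hpw hwn hLp hnop,
                ← hbad w c hwn hcn (fun h => hwa h.1) (fun h => hwc h.1)]
              exact (hac_ref w hwn hwa hwc).symm
            · have hLp' : Lr' p := ((ih p hpw).1 hpn (by omega)).mpr hLp
              have hnop' : ∀ q, p < q → q < w → ¬ Lr' q := by
                intro q h1 h2 hq
                by_cases hqc : q = c
                · subst hqc; exact hc' hq
                · exact hnop q h1 h2 (((ih q h2).1 (by omega) hqc).mp hq)
              rw [hSem' p w hpw hwn hLp' hnop', hSem p w hpw hwn hLp hnop]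
              exact (hbad w p hwn hpn (fun h => hwc (by omega)) (fun h => hwc h.1)).symm
      · -- at `c`, when `a` is not the nearest left record
        intro hwc hna
        subst hwc
        obtain ⟨p, hpw, hLp, hnop⟩ := exists_nearest_left hL0 (show 0 < w by omega)
        have hpa : p ≠ a := fun h => hna ⟨h ▸ hLp, h ▸ hnop⟩
        have hpn : p ≤ n := by omega
        have hLp' : Lr' p := ((ih p hpw).1 hpn (by omega)).mpr hLp
        have hnop' : ∀ q, p < q → q < w → ¬ Lr' q := fun q h1 h2 hq =>
          hnop q h1 h2 (((ih q h2).1 (by omega) (by omega)).mp hq)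
        rw [hSem' p w hpw hcn hLp' hnop', hSem p w hpw hcn hLp hnop]
        exact (hbad w p hcn hpn (fun h => by omega) (fun h => hpa h.2)).symm
  refine ⟨fun u hu huc => (main u).1 hu huc, (main c).2 rfl, fun hna => ⟨?_, fun q h1 h2 hq => ?_⟩⟩
  · exact ((main a).1 han (by omega)).mpr hna.1
  · exact hna.2 q h1 h2 (((main q).1 (by omega) (by omega)).mp hq)

/-- **(F1), right chain** (mirror of `left_transposition`, by reflection): the right records agree at every label `≠ a`; they agree at `a`
unless `c` is the nearest right record of `a`; and if `c` is the nearest right record of `a` in the first state it is so in the second.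
[folklore] -/
theorem right_transposition (S S' : ℕ → β) (e n a c : ℕ) {Rr Rr' : ℕ → Prop} (hac : a < c) (hcn : c ≤ n)
    (hRn : Rr n) (hRn' : Rr' n)
    (hSemR : ∀ u r, u < r → r ≤ n → Rr r → (∀ q, u < q → q < r → ¬ Rr q) →
      (Rr u ↔ ((Even (u + e) → S u < S r) ∧ (¬ Even (u + e) → S r < S u))))
    (hSemR' : ∀ u r, u < r → r ≤ n → Rr' r → (∀ q, u < q → q < r → ¬ Rr' q) →
      (Rr' u ↔ ((Even (u + e) → S' u < S' r) ∧ (¬ Even (u + e) → S' r < S' u))))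
    (hord : ∀ p q, p ≤ n → q ≤ n → ¬(p = a ∧ q = c) → ¬(p = c ∧ q = a) → (S p < S q ↔ S' p < S' q))
    (hdis : ∀ p q, p ≤ n → q ≤ n → p ≠ q → S p ≠ S q)
    (hadj : ∀ q, q ≤ n → q ≠ a → q ≠ c → (S q < S a ↔ S q < S c)) :
    (∀ u, u ≤ n → u ≠ a → (Rr' u ↔ Rr u)) ∧
      ((¬ (Rr c ∧ ∀ q, a < q → q < c → ¬ Rr q)) → (Rr' a ↔ Rr a)) ∧
      ((Rr c ∧ ∀ q, a < q → q < c → ¬ Rr q) → (Rr' c ∧ ∀ q, a < q → q < c → ¬ Rr' q)) := by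
  have han : a ≤ n := hac.le.trans hcn
  -- the reflected states
  have hT := semL_reflect_of_semR S e n hSemR
  have hT' := semL_reflect_of_semR S' e n hSemR'
  have hordT : ∀ p q, p ≤ n → q ≤ n → ¬(p = n - c ∧ q = n - a) → ¬(p = n - a ∧ q = n - c) →
      (S (n - p) < S (n - q) ↔ S' (n - p) < S' (n - q)) := fun p q hp hq h1 h2 =>
    hord (n - p) (n - q) (Nat.sub_le n p) (Nat.sub_le n q) (fun h => h2 ⟨by omega, by omega⟩) (fun h => h1 ⟨by omega, by omega⟩)
  have hdisT : ∀ p q, p ≤ n → q ≤ n → p ≠ q → S (n - p) ≠ S (n - q) := fun p q hp hq hpq =>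
    hdis (n - p) (n - q) (Nat.sub_le n p) (Nat.sub_le n q) (by omega)
  have hadjT : ∀ q, q ≤ n → q ≠ n - c → q ≠ n - a → (S (n - q) < S (n - (n - c)) ↔ S (n - q) < S (n - (n - a))) := by
    intro q hq h1 h2
    rw [show n - (n - c) = c by omega, show n - (n - a) = a by omega]
    exact (hadj (n - q) (Nat.sub_le n q) (by omega) (by omega)).symm
  have hR0 : Rr (n - 0) := by rw [Nat.sub_zero]; exact hRn
  have hR0' : Rr' (n - 0) := by rw [Nat.sub_zero]; exact hRn'
  obtain ⟨h1, h2, h3⟩ := left_transposition (fun u => S (n - u)) (fun u => S' (n - u)) (e + n) n (n - c) (n - a)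
    (Lr := fun u => Rr (n - u)) (Lr' := fun u => Rr' (n - u)) (by omega) (Nat.sub_le n a) hR0 hR0' hT hT' hordT hdisT hadjT
  have hca : n - (n - a) = a := by omega
  have hcc : n - (n - c) = c := by omega
  -- translate «`n - c` is the nearest left record of `n - a` in the reflected state»
  have htr1 : (Rr c ∧ ∀ q, a < q → q < c → ¬ Rr q) →
      (Rr (n - (n - c)) ∧ ∀ q, n - c < q → q < n - a → ¬ Rr (n - q)) := by
    rintro ⟨hc, hno⟩
    rw [hcc]
    exact ⟨hc, fun q hq1 hq2 => hno (n - q) (by omega) (by omega)⟩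
  have htr2 : (Rr (n - (n - c)) ∧ ∀ q, n - c < q → q < n - a → ¬ Rr (n - q)) →
      (Rr c ∧ ∀ q, a < q → q < c → ¬ Rr q) := by
    rintro ⟨hc, hno⟩
    rw [hcc] at hc
    refine ⟨hc, fun q hq1 hq2 hq => hno (n - q) (by omega) (by omega) ?_⟩
    rwa [show n - (n - q) = q by omega]
  refine ⟨fun u hu hua => ?_, fun hna => ?_, fun hna => ?_⟩
  · have := h1 (n - u) (Nat.sub_le n u) (by omega)
    rwa [show n - (n - u) = u by omega] at this
  · have := h2 (fun h => hna (htr2 h))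
    rwa [hca] at this
  · obtain ⟨hc', hno'⟩ := h3 (htr1 hna)
    rw [hcc] at hc'
    refine ⟨hc', fun q hq1 hq2 hq => hno' (n - q) (by omega) (by omega) ?_⟩
    rwa [show n - (n - q) = q by omega]

end TwoChains

end StaticPathFold

end Summit.ValiantsHypothesis.ValiantsHypothesis.Theorems.KPlusLogSqLaw
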